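import Literature.NumberTheory.Transcendental.ExtrapolationBound
import HarnessLib

/-!
# The extrapolation estimate with scaled Cauchy radius

Topic: `Literature/NumberTheory/Transcendental`. Plan item W4/S5 (refinement) of the unit
`provefact-Literature.NumberTheory.Transcendental.H-b596640137`. `Extrapolation.norm_extrapFun_le`
applies Cauchy's estimate on the UNIT circle in `ξ`, which evaluates `F_P` at distance `‖x‖`
from the line and costs `e^{C·D·‖x‖²}` — for the grid directions `x_c` (`‖x_c‖ ≤ kX`) a loss
`e^{C D k²X²}` that no admissible choice of parameters can pay in low dimension (review of
`ClosingDichotomy`). The classical remedy (Baker 1975, Ch. 2, Lemma 4: Cauchy on a circle of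
radius adapted to the point) is to take the radius `r = 1/(kX + 1)`, so that `‖ξ x‖ ≤ 1`: the
loss becomes `k!·(kX+1)^k`, of the harmless shape `e^{O(k log(kX))}`. PROVED:

* `norm_extrapFun_le_radius` — Cauchy with any radius `r > 0`:
  `|φ_{x,k}(z)| ≤ k!·‖P‖₁·e^{C(1+(‖z‖‖v‖ + r‖x‖)²)·D} / r^k`;
* `BakerData.norm_extrapFun_grid_le₂` — the extrapolation estimate for grid directions with
  `r = 1/(kX+1)`:
  `|φ_{x_c,k}(s)| ≤ k!·(kX+1)^k·#U·H_ξ·e^{C(1+(R‖v‖+1)²)·D}·(2(s+S₀)/R)^{(T-k)(S₀+1)}`.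

## References

* A. Baker, *Transcendental Number Theory*, CUP 1975, Ch. 2, Lemma 4.
* A. Baker, G. Wüstholz, *Logarithmic Forms and Diophantine Geometry*, CUP 2007, §6.8 (p. 119).
-/

noncomputable section

open Complex Metric Set MvPolynomial Finset NumberField
open scoped PeriodPair

namespace Literature.NumberTheory.Transcendental

namespace GaGmE

namespace Std

variable {β γ δ : Type} [Fintype β] [Fintype γ] [Fintype δ] [DecidableEq γ]
variable (L : PeriodPair) (κM : δ → γ → Kbar)

/-- **Cauchy with an adapted radius.** For `r > 0`:
`|φ_{x,k}(z)| ≤ k! · ‖P‖₁ · e^{C(1 + (‖z‖‖v‖ + r‖x‖)²)·D} / r^k`. [cite: Baker1975, Ch. 2 Lemma 4] -/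
theorem norm_extrapFun_le_radius {C : ℝ} (hC0 : 0 ≤ C)
    (hC : ∀ (J : Option β × ThetaIdx γ δ) (w : β ⊕ (γ ⊕ δ) → ℂ), ‖theta L κM J w‖ ≤ Real.exp (C * (1 + ‖w‖ ^ 2)))
    {P : MvPolynomial (Option β × ThetaIdx γ δ) ℂ} {D : ℕ} (hP : P.totalDegree ≤ D)
    (v x : β ⊕ (γ ⊕ δ) → ℂ) (k : ℕ) (z : ℂ) {r : ℝ} (hr : 0 < r) :
    ‖extrapFun L κM P v x k z‖ ≤
      k.factorial * (Nesterenko.l1Norm P * Real.exp (C * (1 + (‖z‖ * ‖v‖ + r * ‖x‖) ^ 2)) ^ D) / r ^ k := by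
  unfold extrapFun
  have hF : Differentiable ℂ (thetaEval L κM P) := fun w => (analyticAt_thetaEval L κM P w).differentiableAt
  have hdiff : Differentiable ℂ (fun ξ : ℂ => thetaEval L κM P (z • v + ξ • x)) :=
    hF.comp ((differentiable_const _).add (differentiable_id.smul_const x))
  have hbound : ∀ ξ ∈ sphere (0 : ℂ) r, ‖thetaEval L κM P (z • v + ξ • x)‖ ≤
      Nesterenko.l1Norm P * Real.exp (C * (1 + (‖z‖ * ‖v‖ + r * ‖x‖) ^ 2)) ^ D := by
    intro ξ hξ
    have hξ1 : ‖ξ‖ = r := by simpa using hξ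
    refine (norm_thetaEval_le L κM hC0 hC hP _).trans ?_
    have hw : ‖z • v + ξ • x‖ ≤ ‖z‖ * ‖v‖ + r * ‖x‖ := by
      refine (norm_add_le _ _).trans (add_le_add ?_ ?_)
      · exact (norm_smul_le z v)
      · rw [norm_smul, hξ1]
    have hexp : Real.exp (C * (1 + ‖z • v + ξ • x‖ ^ 2)) ≤ Real.exp (C * (1 + (‖z‖ * ‖v‖ + r * ‖x‖) ^ 2)) := by
      refine Real.exp_le_exp.mpr (mul_le_mul_of_nonneg_left ?_ hC0)
      have := pow_le_pow_left₀ (norm_nonneg _) hw 2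
      linarith
    exact mul_le_mul_of_nonneg_left (pow_le_pow_left₀ (Real.exp_nonneg _) hexp D) (Nesterenko.l1Norm_nonneg P)
  exact Complex.norm_iteratedDeriv_le_of_forall_mem_sphere_norm_le (c := 0) k hr hdiff.diffContOnCl hbound

namespace BakerData

variable {L κM}
variable [DecidableEq β] [DecidableEq δ] (B : BakerData β γ δ)

/-- **The extrapolation estimate with scaled radius** (`r = 1/(kX + 1)`): for `v ∈ 𝔟`,
vanishing to order `≥ T` along `𝔟` at `0, …, S₀v`, `c_m ≤ k`, `R ≥ 2(s + S₀)`, `R > 0`: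
`|φ_{x_c,k}(s)| ≤ k!·(kX+1)^k·#U·H_ξ·e^{C(1+(R‖v‖+1)²)·D}·(2(s+S₀)/R)^{(T-k)(S₀+1)}`.
[cite: Baker1975, Ch. 2 Lemma 4; BakerWustholz2007, §6.8 (p. 119)] -/
theorem norm_extrapFun_grid_le₂ {C : ℝ} (hC0 : 0 ≤ C)
    (hC : ∀ (J : Option β × ThetaIdx γ δ) (w : β ⊕ (γ ⊕ δ) → ℂ),
      ‖theta B.L B.κM J w‖ ≤ Real.exp (C * (1 + ‖w‖ ^ 2)))
    (hv : B.v ∈ B.bSpan) {D' : ℕ} (ξ : UIdx β γ δ D' → 𝓞 B.K) {T S₀ : ℕ}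
    (hvan : ∀ s₀ : ℕ, s₀ ≤ S₀ → VanishesAlong B.bSpan (thetaEval B.L B.κM (B.auxForm ξ)) ((s₀ : ℂ) • B.v) T)
    {k : ℕ} {cg : Fin B.dd → ℕ} (hcg : ∀ m, cg m ≤ k) (s : ℕ) {R : ℝ} (hR0 : 0 < R)
    (hR : 2 * ((s : ℝ) + S₀) ≤ R) :
    ‖extrapFun B.L B.κM (B.auxForm ξ) B.v (B.gridDir cg) k s‖ ≤
      k.factorial * ((k : ℝ) * B.dirNorm + 1) ^ k * (Fintype.card (UIdx β γ δ D') * B.houseXi ξ *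
        Real.exp (C * (1 + (R * ‖B.v‖ + 1) ^ 2)) ^ (Fintype.card (β ⊕ (γ ⊕ δ)) * D')) *
        (2 * ((s : ℝ) + S₀) / R) ^ ((T - k) * (S₀ + 1)) := by
  set D := Fintype.card (β ⊕ (γ ⊕ δ)) * D' with hD
  set f := extrapFun B.L B.κM (B.auxForm ξ) B.v (B.gridDir cg) k with hf
  set r : ℝ := 1 / ((k : ℝ) * B.dirNorm + 1) with hr
  have hX0 := B.dirNorm_nonneg
  have hr0 : 0 < r := by rw [hr]; positivity
  have hrx : r * ‖B.gridDir cg‖ ≤ 1 := by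
    have hX := B.norm_gridDir_le hcg
    rw [hr, one_div, inv_mul_le_iff₀ (by positivity)]
    linarith
  set pts : Finset ℂ := (Finset.range (S₀ + 1)).image (fun j : ℕ => (j : ℂ)) with hpts
  have hcard : pts.card = S₀ + 1 := by
    rw [hpts, Finset.card_image_of_injective _ Nat.cast_injective, Finset.card_range]
  have hdiff : Differentiable ℂ f := differentiable_extrapFun B.L B.κM _ _ _ k
  have hord : ∀ c ∈ pts, ((T - k : ℕ) : ℕ∞) ≤ analyticOrderAt f c := by
    intro c hc
    obtain ⟨j, hj, rfl⟩ := Finset.mem_image.mp hc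
    have hjS : j ≤ S₀ := Nat.lt_succ_iff.mp (Finset.mem_range.mp hj)
    exact le_analyticOrderAt_extrapFun B.L B.κM _ hv (B.gridDir_mem cg) (hvan j hjS) k
  -- the bound on the circle `|z| = R` with Cauchy radius `r` in `ξ`
  set θ : ℝ := k.factorial * (Nesterenko.l1Norm (B.auxForm ξ) *
    Real.exp (C * (1 + (R * ‖B.v‖ + 1) ^ 2)) ^ D) / r ^ k with hθ
  have hθb : ∀ z ∈ sphere (0 : ℂ) R, ‖f z‖ ≤ θ := by
    intro z hz
    have hzR : ‖z‖ = R := by simpa using hz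
    have h := norm_extrapFun_le_radius B.L B.κM hC0 hC (P := B.auxForm ξ) (D := D)
      ((isHomogeneous_homog D (B.QOf ξ)).totalDegree_le) B.v (B.gridDir cg) k z hr0
    rw [hzR] at h
    refine h.trans ?_
    rw [hθ]
    refine div_le_div_of_nonneg_right (mul_le_mul_of_nonneg_left (mul_le_mul_of_nonneg_left
      (pow_le_pow_left₀ (Real.exp_nonneg _) (Real.exp_le_exp.mpr (mul_le_mul_of_nonneg_left ?_ hC0)) D)
      (Nesterenko.l1Norm_nonneg _)) (Nat.cast_nonneg _)) (pow_nonneg hr0.le _)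
    have h1 : 0 ≤ R * ‖B.v‖ + r * ‖B.gridDir cg‖ := by positivity
    nlinarith
  -- separation and products as in `norm_extrapFun_grid_le`
  have hsep : ∀ z ∈ sphere (0 : ℂ) R, ∀ c ∈ pts, R / 2 ≤ ‖z - c‖ := by
    intro z hz c hc
    have hzR : ‖z‖ = R := by simpa using hz
    obtain ⟨j, hj, rfl⟩ := Finset.mem_image.mp hc
    have hjS : (j : ℝ) ≤ S₀ := by exact_mod_cast Nat.lt_succ_iff.mp (Finset.mem_range.mp hj)
    have h1 : ‖z‖ - ‖(j : ℂ)‖ ≤ ‖z - (j : ℂ)‖ := norm_sub_norm_le z j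
    rw [hzR, Complex.norm_natCast] at h1
    have hs0 : (0 : ℝ) ≤ s := Nat.cast_nonneg s
    linarith
  have hm : (0 : ℝ) < (R / 2) ^ ((T - k) * pts.card) := pow_pos (by linarith) _
  have hmF : ∀ z ∈ sphere (0 : ℂ) R, (R / 2) ^ ((T - k) * pts.card) ≤ ‖∏ c ∈ pts, (z - c) ^ (T - k)‖ :=
    fun z hz => Baker1975.Analytic.le_norm_prod_pow pts (T - k) (by linarith) (hsep z hz)
  have hsR : ‖(s : ℂ)‖ ≤ R := by
    rw [Complex.norm_natCast]
    have : (0 : ℝ) ≤ S₀ := Nat.cast_nonneg S₀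
    have hs0 : (0 : ℝ) ≤ s := Nat.cast_nonneg s
    linarith
  have hmain := Baker1975.Analytic.norm_le_of_analyticOrderAt hdiff pts (T - k) hord hR0 hθb hm hmF hsR
  have hup : ‖∏ c ∈ pts, ((s : ℂ) - c) ^ (T - k)‖ ≤ ((s : ℝ) + S₀) ^ ((T - k) * pts.card) := by
    refine Baker1975.Analytic.norm_prod_pow_le pts (T - k) fun c hc => ?_
    obtain ⟨j, hj, rfl⟩ := Finset.mem_image.mp hc
    have hjS : (j : ℝ) ≤ S₀ := by exact_mod_cast Nat.lt_succ_iff.mp (Finset.mem_range.mp hj)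
    calc ‖(s : ℂ) - (j : ℂ)‖ ≤ ‖(s : ℂ)‖ + ‖(j : ℂ)‖ := norm_sub_le _ _
      _ = s + j := by rw [Complex.norm_natCast, Complex.norm_natCast]
      _ ≤ s + S₀ := by linarith
  rw [hcard] at hm hup hmain
  have hθ0 : 0 ≤ θ := by
    rw [hθ]; have := Nesterenko.l1Norm_nonneg (B.auxForm ξ); positivity
  have step1 : ‖f s‖ ≤ θ * (2 * ((s : ℝ) + S₀) / R) ^ ((T - k) * (S₀ + 1)) := by
    refine hmain.trans ?_
    have e : θ / (R / 2) ^ ((T - k) * (S₀ + 1)) * ((s : ℝ) + S₀) ^ ((T - k) * (S₀ + 1)) =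
        θ * (2 * ((s : ℝ) + S₀) / R) ^ ((T - k) * (S₀ + 1)) := by
      rw [show 2 * ((s : ℝ) + S₀) / R = (2 / R) * ((s : ℝ) + S₀) from by ring, mul_pow, div_pow, div_pow]
      field_simp
    rw [← e]
    exact mul_le_mul_of_nonneg_left hup (div_nonneg hθ0 hm.le)
  refine step1.trans (mul_le_mul_of_nonneg_right ?_ (by positivity))
  -- `θ ≤ k!·(kX+1)^k·#U·H_ξ·e^{…}`
  rw [hθ, hr, one_div, inv_pow, div_eq_mul_inv, inv_inv]
  have hcoeff := (B.l1Norm_homog_QOf_le ξ).trans (B.sum_norm_xi_le ξ)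
  have hHξ := B.one_le_houseXi ξ
  have hE0 : 0 ≤ Real.exp (C * (1 + (R * ‖B.v‖ + 1) ^ 2)) ^ D := pow_nonneg (Real.exp_nonneg _) _
  have hkX : 0 ≤ ((k : ℝ) * B.dirNorm + 1) ^ k := by positivity
  calc (k.factorial : ℝ) * (Nesterenko.l1Norm (B.auxForm ξ) * Real.exp (C * (1 + (R * ‖B.v‖ + 1) ^ 2)) ^ D) *
        ((k : ℝ) * B.dirNorm + 1) ^ k
      ≤ (k.factorial : ℝ) * ((Fintype.card (UIdx β γ δ D') * B.houseXi ξ) *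
          Real.exp (C * (1 + (R * ‖B.v‖ + 1) ^ 2)) ^ D) * ((k : ℝ) * B.dirNorm + 1) ^ k := by
        refine mul_le_mul_of_nonneg_right (mul_le_mul_of_nonneg_left
          (mul_le_mul_of_nonneg_right hcoeff hE0) (Nat.cast_nonneg _)) hkX
    _ = _ := by ring

end BakerData

end Std

end GaGmE

end Literature.NumberTheory.Transcendental

end
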